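import Summits.QuantumAdvantage.QuantumAdvantage.Theorems.LinnikCubicClassGroupsDegreeOnePrimesEscapeClassShortIntervalPsiDH
import Summits.QuantumAdvantage.QuantumAdvantage.Theorems.LinnikCubicClassGroupsDegreeOnePrimesEscapeShortIntervalDHPrelims
import HarnessLib

/-!
# Prime ideals of a class in short intervals with Deuring–Heilbronn, IV: the two-sided class PNT

Topic `Summits/QuantumAdvantage/QuantumAdvantage/Theorems`, cell B2b-1 (linnik-cubic), PART A (gen 19); helper
toward the crux `DegreeOnePrimesEscape` (stmt-QuantumAdvantage-11543) of route `LinnikCubicClassGroups`.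
HONEST FRAMING: the value of this file is a THEOREM (kernel-checked, GRH-free, Siegel-free) — NOT summit progress.

**The prime number theorem for an ideal class in short intervals of the Linnik range, Deuring–Heilbronn-sharp.**
`classPsi_shortInterval_dh`: for every `n > 1` and `κ > 0` there are `δ ∈ (0, 1/64]`, `a ≥ 1`, `c > 0` such that
for EVERY number field `K` of degree `n`, EVERY ideal class `C`, every `x ≥ Q^{a}` (`Q = |d_K|·nⁿ`) and
`x^{1−δ} ≤ h ≤ x`, with `ψ_C(y) = Σ_{N𝔞 ≤ y, [𝔞] = C} Λ(𝔞)` and `I = ∫_x^{x+h} t^{β₁−1} dt`: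
* (A) if no real class group character of `K` has a real zero in `(1 − c/(log|d_K| + log 4), 1)`:
  `|h_K(ψ_C(x+h) − ψ_C(x)) − h| ≤ κ h`;
* (B) if the real character `χ₁` has the zero `β₁` there (Landau–Page: at most one such pair):
  `χ₁(C) = +1` ⇒ `|h_K(ψ_C(x+h) − ψ_C(x)) − (h − I)| ≤ κ (h − I)` (RELATIVE to the flat main term, `h − I > 0`);
  `χ₁(C) = −1` ⇒ `|h_K(ψ_C(x+h) − ψ_C(x)) − (h + I)| ≤ κ · min(1, (1−β₁) log x) · h`.
Corollary `classPsi_shortInterval_lower`: `h_K(ψ_C(x+h) − ψ_C(x)) ≥ (c₁/4) Q^{−2} h` for EVERY class, unconditionally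
(Stark's effective `1 − β₁ ≥ c₁Q^{−2}` in the flat case).  Gen 5 (`classPsi_shortInterval_dichotomy`) had the
one-sided form with constants `1/8, 8` and no lower bound for the classes `χ₁(C) = +1` in even degree; the printed
short-interval theorems for Chebotarev/ideal classes (Balog–Ono 2001, fixed field; Gun–Naik 2024 Thm 7) have an
absolute error, which the flat main term does not dominate.
References: [LagariasMontgomeryOdlyzko1979, §7]; [ThornerZaman2019, Thm. 3.1]; G. Hoheisel (1930).
-/

noncomputable section

open Complex Real
open scoped NumberField nonZeroDivisors

namespace Summit.QuantumAdvantage.QuantumAdvantage.Theorems.DegreeOnePrimesEscape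

open Literature.NumberTheory.LFunctions Literature.NumberTheory.LFunctions.NumberField
  Literature.NumberTheory.LFunctions.AbelianDensity

set_option maxHeartbeats 1600000 in
/-- **The class prime number theorem in short intervals of the Linnik range, two-sided, Deuring–Heilbronn-sharp,
every ideal class of every number field of degree `n`** (see the module docstring).
[cite: LagariasMontgomeryOdlyzko1979, §7] [cite: ThornerZaman2019, Theorem 3.1] -/
theorem classPsi_shortInterval_dh (n : ℕ) (hn : 1 < n) {κ : ℝ} (hκ : 0 < κ) :
    ∃ δ a c : ℝ, 0 < δ ∧ δ ≤ 1 / 64 ∧ 1 ≤ a ∧ 0 < c ∧ c ≤ 1 / (8 * ((n : ℝ) ^ 2 + 1)) ∧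
    ∀ (K : Type) [Field K] [NumberField K], Module.finrank ℚ K = n →
      ∀ (C : ClassGroup (𝓞 K)) (x h : ℝ), ThornerZaman.condQn K ^ a ≤ x → x ^ (1 - δ) ≤ h → h ≤ x →
      ((¬ ∃ (χ₁ : ClassGroup (𝓞 K) →* ℂˣ) (β₁ : ℝ), χ₁ * χ₁ = 1 ∧ classGroupLFunction K χ₁ β₁ = 0 ∧
            1 - c / (Real.log ((NumberField.discr K).natAbs : ℝ) + Real.log 4) < β₁ ∧ β₁ < 1) →
          |(NumberField.classNumber K : ℝ) * (classPsi K C (x + h) - classPsi K C x) - h| ≤ κ * h) ∧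
      (∀ (χ₁ : ClassGroup (𝓞 K) →* ℂˣ) (β₁ : ℝ), χ₁ * χ₁ = 1 → classGroupLFunction K χ₁ β₁ = 0 →
          1 - c / (Real.log ((NumberField.discr K).natAbs : ℝ) + Real.log 4) < β₁ → β₁ < 1 →
          ((χ₁ C : ℂ) = 1 →
            |(NumberField.classNumber K : ℝ) * (classPsi K C (x + h) - classPsi K C x) -
                (h - ((x + h) ^ β₁ - x ^ β₁) / β₁)| ≤ κ * (h - ((x + h) ^ β₁ - x ^ β₁) / β₁)) ∧
          ((χ₁ C : ℂ) = -1 →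
            |(NumberField.classNumber K : ℝ) * (classPsi K C (x + h) - classPsi K C x) -
                (h + ((x + h) ^ β₁ - x ^ β₁) / β₁)| ≤ κ * min 1 ((1 - β₁) * Real.log x) * h)) := by
  obtain ⟨δ, a, c, hδ, hδ64, ha, hc, hcn, hmain⟩ := classPsi_shortInterval_dichotomy_dh n hn (half_pos hκ)
  refine ⟨δ, a, c, hδ, hδ64, ha, hc, hcn, fun K _ _ hKn C x h hx hhx hhx' ↦ ?_⟩
  obtain ⟨hA, hB⟩ := hmain K hKn x h hx hhx hhx'
  have hK : 1 < Module.finrank ℚ K := by rw [hKn]; exact hn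
  have hQ12 : (12 : ℝ) ≤ ThornerZaman.condQn K := ThornerZaman.twelve_le_condQn (K := K) hK
  have hxQ : ThornerZaman.condQn K ≤ x := by
    have := (Real.rpow_le_rpow_of_exponent_le (by linarith : (1 : ℝ) ≤ ThornerZaman.condQn K) ha).trans hx
    rwa [Real.rpow_one] at this
  have hx1 : 1 ≤ x := by linarith
  have hx0 : 0 < x := by linarith
  have hh0 : 0 ≤ h := le_trans (Real.rpow_nonneg hx0.le _) hhx
  refine ⟨fun hno ↦ ?_, fun χ₁ β₁ hreal hLz hwin hβ1 ↦ ⟨fun hC ↦ ?_, fun hC ↦ ?_⟩⟩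
  · have := hA hno C
    have h2 : κ / 2 * h ≤ κ * h := by nlinarith
    exact this.trans h2
  · -- the flat case `χ₁(C) = +1`: error relative to `h − I ≥ (h/2)·min(1,(1−β₁)log x)`
    have key := hB χ₁ β₁ hreal hLz hwin hβ1 C
    rw [hC, Complex.one_re, one_mul] at key
    have hβhalf : 1 / 2 ≤ β₁ := half_le_of_window (N := K) (n₀ := n) hcn hwin
    have hflat := half_min_mul_le_flat hx1 hh0 (by linarith) hβ1
    have hmin0 : 0 ≤ min 1 ((1 - β₁) * Real.log x) :=
      le_min zero_le_one (mul_nonneg (by linarith) (Real.log_nonneg hx1))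
    refine key.trans ?_
    have := mul_le_mul_of_nonneg_left hflat hκ.le
    nlinarith
  · -- the case `χ₁(C) = −1`: main term `h + I`
    have key := hB χ₁ β₁ hreal hLz hwin hβ1 C
    rw [hC, Complex.neg_re, Complex.one_re, neg_mul, one_mul, sub_neg_eq_add] at key
    refine key.trans ?_
    have hmin0 : 0 ≤ min 1 ((1 - β₁) * Real.log x) :=
      le_min zero_le_one (mul_nonneg (by linarith) (Real.log_nonneg hx1))
    have : 0 ≤ κ * min 1 ((1 - β₁) * Real.log x) * h := by positivity
    nlinarith

set_option maxHeartbeats 1600000 in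
/-- **A uniform lower bound in every short interval of the Linnik range, every class of every number field of
degree `n`, unconditionally**: there are `δ ∈ (0, 1/64]`, `a ≥ 1`, `c₁ ∈ (0, 1]` with
`h_K(ψ_C(x+h) − ψ_C(x)) ≥ (c₁/4)·Q^{−2}·h` for `x ≥ Q^{a}`, `x^{1−δ} ≤ h ≤ x` (`Q = |d_K|·nⁿ`).  In the flat case
`χ₁(C) = +1` this is Deuring–Heilbronn plus Stark's `1 − β₁ ≥ c₁Q^{−2}`; otherwise the bound is `≥ h/2`. -/
theorem classPsi_shortInterval_lower (n : ℕ) (hn : 1 < n) :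
    ∃ δ a c₁ : ℝ, 0 < δ ∧ δ ≤ 1 / 64 ∧ 1 ≤ a ∧ 0 < c₁ ∧ c₁ ≤ 1 ∧
    ∀ (K : Type) [Field K] [NumberField K], Module.finrank ℚ K = n →
      ∀ (C : ClassGroup (𝓞 K)) (x h : ℝ), ThornerZaman.condQn K ^ a ≤ x → x ^ (1 - δ) ≤ h → h ≤ x →
        c₁ / 4 * ThornerZaman.condQn K ^ (-(2 : ℝ)) * h ≤
          (NumberField.classNumber K : ℝ) * (classPsi K C (x + h) - classPsi K C x) := by
  classical
  obtain ⟨δ, a, c, hδ, hδ64, ha, hc, hcn, hmain⟩ := classPsi_shortInterval_dh n hn (by norm_num : (0 : ℝ) < 1 / 2)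
  obtain ⟨c₁, hc₁, hc₁1, heff⟩ := Residue.one_sub_realZero_ge_condQn_rpow n hn
  refine ⟨δ, a, c₁, hδ, hδ64, ha, hc₁, hc₁1, fun K _ _ hKn C x h hx hhx hhx' ↦ ?_⟩
  obtain ⟨hA, hB⟩ := hmain K hKn C x h hx hhx hhx'
  have hK : 1 < Module.finrank ℚ K := by rw [hKn]; exact hn
  set Q : ℝ := ThornerZaman.condQn K with hQ
  have hQ12 : (12 : ℝ) ≤ Q := ThornerZaman.twelve_le_condQn (K := K) hK
  have hQ1 : (1 : ℝ) < Q := by linarith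
  have hQ0 : (0 : ℝ) < Q := by linarith
  have hxQ : Q ≤ x := by
    have := (Real.rpow_le_rpow_of_exponent_le hQ1.le ha).trans hx
    rwa [Real.rpow_one] at this
  have hx1 : 1 < x := by linarith
  have hx0 : 0 < x := by linarith
  have hh0 : 0 ≤ h := le_trans (Real.rpow_nonneg hx0.le _) hhx
  have hQm2 : 0 < Q ^ (-(2 : ℝ)) := Real.rpow_pos_of_pos hQ0 _
  have hQm2le : Q ^ (-(2 : ℝ)) ≤ 1 := Real.rpow_le_one_of_one_le_of_nonpos hQ1.le (by norm_num)
  have hm1 : c₁ * Q ^ (-(2 : ℝ)) ≤ 1 := (mul_le_mul hc₁1 hQm2le hQm2.le zero_le_one).trans (by norm_num)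
  have hmh : c₁ / 4 * Q ^ (-(2 : ℝ)) * h ≤ h / 2 := by
    have := mul_le_mul_of_nonneg_right hm1 hh0; nlinarith
  obtain ⟨-, -, hlog12⟩ := log_small_consts
  have hlogx : 1 ≤ Real.log x := by
    have := hlog12.trans (Real.log_le_log (by norm_num) (hQ12.trans hxQ)); linarith
  by_cases hex : ∃ (χ₁ : ClassGroup (𝓞 K) →* ℂˣ) (β₁ : ℝ), χ₁ * χ₁ = 1 ∧ classGroupLFunction K χ₁ β₁ = 0 ∧
      1 - c / (Real.log ((NumberField.discr K).natAbs : ℝ) + Real.log 4) < β₁ ∧ β₁ < 1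
  · obtain ⟨χ₁, β₁, hreal, hLz, hwin, hβ1⟩ := hex
    obtain ⟨hflat, hplus⟩ := hB χ₁ β₁ hreal hLz hwin hβ1
    have hβhalf : 1 / 2 ≤ β₁ := half_le_of_window (N := K) (n₀ := n) hcn hwin
    have hmin0 : 0 ≤ min 1 ((1 - β₁) * Real.log x) :=
      le_min zero_le_one (mul_nonneg (by linarith) (Real.log_nonneg hx1.le))
    have hmin1 : min 1 ((1 - β₁) * Real.log x) ≤ 1 := min_le_left _ _
    have hI0 : 0 ≤ ((x + h) ^ β₁ - x ^ β₁) / β₁ := by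
      refine div_nonneg ?_ (by linarith)
      have := Real.rpow_le_rpow hx0.le (show x ≤ x + h by linarith) (by linarith : 0 ≤ β₁)
      linarith
    rcases classGroupChar_apply_eq_one_or_eq_neg_one hreal C with hC | hC
    · -- flat: `h_K Δψ ≥ (1/2)(h − I) ≥ (h/4)·min(1,(1−β₁)log x) ≥ (c₁/4) Q^{-2} h`
      have key := (abs_le.1 (hflat hC)).1
      have hfl := half_min_mul_le_flat hx1.le hh0 (by linarith) hβ1
      have hδlow : c₁ * Q ^ (-(2 : ℝ)) ≤ 1 - β₁ := heff K hKn χ₁ hreal β₁ hβ1 hLz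
      have hμ : c₁ * Q ^ (-(2 : ℝ)) ≤ min 1 ((1 - β₁) * Real.log x) := by
        refine le_min hm1 (hδlow.trans ?_)
        exact le_mul_of_one_le_right (by linarith) hlogx
      have h1 : c₁ / 4 * Q ^ (-(2 : ℝ)) * h ≤ h / 4 * min 1 ((1 - β₁) * Real.log x) := by
        have := mul_le_mul_of_nonneg_right hμ hh0; nlinarith
      nlinarith
    · have key := (abs_le.1 (hplus hC)).1
      have : 1 / 2 * min 1 ((1 - β₁) * Real.log x) * h ≤ h / 2 := by nlinarith
      linarith
  · have key := (abs_le.1 (hA hex)).1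
    linarith

end Summit.QuantumAdvantage.QuantumAdvantage.Theorems.DegreeOnePrimesEscape

end
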